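import Mathlib.Analysis.SpecialFunctions.Pow.Real
import Mathlib.Algebra.Order.BigOperators.Ring.Finset
import HarnessLib

/-!
# Aaronson's `PP ⊆ PostBQP`, I: deciding the sign of a gap by a unanimity test over dyadic scales

Topic `Literature/Computability/QuantumComplexity`; first file towards the inclusion `PP ⊆ PostBQP`
(S. Aaronson, *Quantum computing, postselection, and probabilistic polynomial-time*, Proc. R. Soc.
A 461 (2005) 3473–3482 = arXiv:quant-ph/0412187, Thm. 4 of the arXiv text: `PostBQP = PP`, the
direction "`PP ⊆ PostBQP`"), which is the hypothesis `h : PP ⊆ PostBQP` of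
`PH_eq_DeltaP_three_of_uniform_iqp_multiplicative_of_two_facts` (`IQPPostselectionProofs.lean`,
Bremner–Jozsa–Shepherd Cor. 1) and one half of the named fact `Cryptography.PostBQP_eq_PP`.

**The printed algorithm** (arXiv p. 6). For `f : {0,1}ⁿ → {0,1}` with `s = |f⁻¹(1)|` one must
decide `s < 2^{n-1}` versus `s ≥ 2^{n-1}`. Hadamards, `U_f`, Hadamards and post-selection of the
query register on `0ⁿ` leave `|ψ⟩ ∝ (2ⁿ - s)|0⟩ + s|1⟩`; for `β/α = 2^i`, `i ∈ [-n, n]`, the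
post-selected state `|φ_{2^i}⟩ ∝ α s|0⟩ + β (2ⁿ - 2s)/√2 |1⟩` is close to `|+⟩` for SOME `i` if
`2ⁿ - 2s > 0` ("there must be an integer `i` … such that `|φ_{2^i}⟩` and `|φ_{2^{i+1}}⟩` fall on
opposite sides of `|+⟩`"), and is never in the first quadrant, `|⟨+|φ⟩| ≤ 1/√2`, for EVERY `i`
otherwise; the two cases are told apart "by repeating the whole algorithm `n(2n+1)` times … with
`n` invocations for each integer `i`" and Prop. 3 (closure of `PostBQP` under intersection:
"postselect on both computations succeeding").

**The variant formalised in this series** replaces the `n` repetitions per scale and the majority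
vote by ONE run per scale and per sign and a *unanimity* post-selection, which needs neither a
Chernoff bound nor intermediate post-selections and fits the tree's `PostBQP` (one output wire,
one post-selection wire): with the gap `G = Σ_u (-1)^{f(u)} ∈ [-2^M, 2^M]` (made nonzero, indeed
`|G| ≥ 2`, by padding) and, for every scale `1 ≤ j ≤ M`, the two one-query circuits
`H^{⊗(M+1)} (-1)^{Φ_{j,±}} H^{⊗(M+1)}` whose return-to-zero amplitudes are `(G ± 2^j)/2^{M+1}`
(the reference amplitude `2^j/2^{M+1}` is Aaronson's `β/α = 2^i` ladder, realised by a second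
phase function instead of a biased control qubit), all `2M` circuits are run side by side;
post-selection is on "all `+` blocks returned to zero OR all `-` blocks returned to zero", the
output is "all `+` blocks returned to zero". The acceptance and rejection weights are the products
`A = ∏ⱼ a_j`, `R = ∏ⱼ r_j` of `a_j = ((G + 2^j)/2^{M+1})²`, `r_j = ((G - 2^j)/2^{M+1})²`, and the
conditional acceptance probability is `A / (A + R - A R)`.

This file is the **real arithmetic** of that test (no circuits):

* `accW`, `rejW`, `accProd`, `rejProd` and their ranges (`accW_le_one`, `accProd_le_one`, …);
* `rejW_le_accW` (`G ≥ 0`: every scale votes weakly for acceptance) and the **good scale**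
  `nine_mul_rejW_le_accW` (`2^j ≤ 2G`, `G ≤ 2^j`: `r_j ≤ a_j/9` — Aaronson's "opposite sides of
  `|+⟩`" estimate in squared form), `exists_scale` (such a `j ∈ [1, M]` exists when `2 ≤ G ≤ 2^M`);
* **`nine_mul_rejProd_le_accProd`** (`2 ≤ G ≤ 2^M ⇒ 9R ≤ A`) and, by the symmetry
  `rejW M G = accW M (-G)`, **`nine_mul_accProd_le_rejProd`** (`-2^M ≤ G ≤ -2 ⇒ 9A ≤ R`);
* `accProd_le` (`M ≥ 2`, `|G| ≤ 2^M ⇒ A ≤ 9/16`, from the scale `j = 1`);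
* the conditional probability: `post_weight_pos` (`A + R - AR > 0`), **`two_thirds_le_cond`**
  (`9R ≤ A`, `A > 0 ⇒ 2/3 ≤ A/(A + R - AR)`) and **`cond_le_one_third`**
  (`9A ≤ R`, `A ≤ 9/16`, `R > 0 ⇒ A/(A + R - AR) ≤ 1/3`) — the thresholds of the tree's `PostBQP`.

## Relation to `PPPostBQPScales.lean` (parallel development, 2026-08-15)

The same one-shot product test was formalised independently, minutes earlier, by the seat of the
named fact `PP_subset_PostIQPWith` in `PPPostBQPScales.lean` (namespace `PPPostBQP`), with the
normalisation `(C ± 2^i G)²` (`C` a fixed power of two, the scale carried by the gap) and the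
decisive-scale constant `4` in place of this file's `((G ± 2^j)/2^{M+1})²` and `9`; the circuit
files of that series (`PP ⊆ PostBQP` proper) continue from there and are the ones to build on.
This file and its classical companion `Complexity/PPSignSum.lean` (`PPSignSum.signSum`, the gap
normal form `PPSignSum.exists_signSum_of_mem_PP`: `R ∈ P`, `q ≥ 3`, sign sum `≤ -2` on members and
`≥ 2` off the language, i.e. the padding "`s > 0`" in two-sided form, and the `±1`-sum over
`Fin M → Bool` matching a block amplitude `Σ_u (-1)^{Φ(u)}`) are kept as a self-contained
alternative normalisation; nothing downstream depends on the choice. (The weights `accW`/`rejW` of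
`PostBQPAmplification.lean`, namespace `PostBQPAmp`, are unrelated objects with the same short
names: qualify when both namespaces are open.)

## References

* S. Aaronson, *Quantum computing, postselection, and probabilistic polynomial-time*, Proc. R.
  Soc. A 461 (2005) 3473–3482, doi:10.1098/rspa.2005.1546, arXiv:quant-ph/0412187: Thm. 4 and its
  proof (p. 6 of the arXiv text), Prop. 3.
* M. J. Bremner, R. Jozsa, D. J. Shepherd, Proc. R. Soc. A 467 (2011) 459–472, arXiv:1005.1407,
  §3.1 (use of `post-BQP = PP`).
-/

noncomputable section

namespace Literature.Computability.QuantumComplexity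

namespace AaronsonPP

open Finset Real

/-! ### The weights of one scale -/

/-- The **acceptance weight** of scale `j`: `a_j = ((G + 2^j)/2^{M+1})²`, the return-to-zero
probability of the `+` block of scale `j` (gap `G`, `M + 1` Hadamard wires).
[cite: Aaronson2005, Thm. 4 (proof)] -/
def accW (M : ℕ) (G : ℝ) (j : ℕ) : ℝ := ((G + 2 ^ j) / 2 ^ (M + 1)) ^ 2

/-- The **rejection weight** of scale `j`: `r_j = ((G - 2^j)/2^{M+1})²`, the return-to-zero
probability of the `-` block of scale `j`. [cite: Aaronson2005, Thm. 4 (proof)] -/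
def rejW (M : ℕ) (G : ℝ) (j : ℕ) : ℝ := ((G - 2 ^ j) / 2 ^ (M + 1)) ^ 2

/-- The symmetry `r_j(G) = a_j(-G)`. [folklore] -/
theorem rejW_eq_accW_neg (M : ℕ) (G : ℝ) (j : ℕ) : rejW M G j = accW M (-G) j := by
  unfold rejW accW
  rw [show (-G + 2 ^ j) = -(G - 2 ^ j) by ring, neg_div, neg_sq]

/-- The symmetry `a_j(G) = r_j(-G)`. [folklore] -/
theorem accW_eq_rejW_neg (M : ℕ) (G : ℝ) (j : ℕ) : accW M G j = rejW M (-G) j := by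
  rw [rejW_eq_accW_neg, neg_neg]

/-- `0 ≤ a_j`. [folklore] -/
theorem accW_nonneg (M : ℕ) (G : ℝ) (j : ℕ) : 0 ≤ accW M G j := sq_nonneg _

/-- `0 ≤ r_j`. [folklore] -/
theorem rejW_nonneg (M : ℕ) (G : ℝ) (j : ℕ) : 0 ≤ rejW M G j := sq_nonneg _

/-- `a_j ≤ 1` for `|G| ≤ 2^M`, `j ≤ M` (then `|G + 2^j| ≤ 2^{M+1}`). [folklore] -/
theorem accW_le_one {M : ℕ} {G : ℝ} {j : ℕ} (hG : |G| ≤ 2 ^ M) (hj : j ≤ M) : accW M G j ≤ 1 := by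
  unfold accW
  have h2j : (2 : ℝ) ^ j ≤ 2 ^ M := pow_le_pow_right₀ (by norm_num) hj
  have hpos : (0 : ℝ) < 2 ^ (M + 1) := by positivity
  have habs : |G + 2 ^ j| ≤ 2 ^ (M + 1) := by
    have h2a : |(2 : ℝ) ^ j| = 2 ^ j := abs_of_nonneg (by positivity)
    calc |G + 2 ^ j| ≤ |G| + |(2 : ℝ) ^ j| := abs_add_le _ _
      _ ≤ 2 ^ M + 2 ^ M := by rw [h2a]; linarith
      _ = 2 ^ (M + 1) := by ring
  have h1 : |(G + 2 ^ j) / 2 ^ (M + 1)| ≤ 1 := by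
    rw [abs_div, abs_of_pos hpos, div_le_one hpos]; exact habs
  have h2 : ((G + 2 ^ j) / 2 ^ (M + 1)) ^ 2 = |(G + 2 ^ j) / 2 ^ (M + 1)| ^ 2 := (sq_abs _).symm
  rw [h2]
  have h0 : 0 ≤ |(G + 2 ^ j) / 2 ^ (M + 1)| := abs_nonneg _
  nlinarith

/-- `r_j ≤ 1` for `|G| ≤ 2^M`, `j ≤ M`. [folklore] -/
theorem rejW_le_one {M : ℕ} {G : ℝ} {j : ℕ} (hG : |G| ≤ 2 ^ M) (hj : j ≤ M) : rejW M G j ≤ 1 := by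
  rw [rejW_eq_accW_neg]
  exact accW_le_one (by rwa [abs_neg]) hj

/-- **Every scale votes weakly for acceptance when `G ≥ 0`**: `r_j ≤ a_j`
(`(G - 2^j)² ≤ (G + 2^j)²`). [cite: Aaronson2005, Thm. 4 (proof)] -/
theorem rejW_le_accW {M : ℕ} {G : ℝ} (hG : 0 ≤ G) (j : ℕ) : rejW M G j ≤ accW M G j := by
  unfold rejW accW
  rw [div_pow, div_pow]
  refine div_le_div_of_nonneg_right ?_ (by positivity)
  have h2 : (0 : ℝ) ≤ 2 ^ j := by positivity
  nlinarith

/-- **The good scale**: if `2^j ≤ 2G` and `G ≤ 2^j` then `9 r_j ≤ a_j` (`3(2^j - G) ≤ G + 2^j`).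
Aaronson: for the right `i` the state `|φ_{2^i}⟩` is within the angle of
`√(2/3)|0⟩ + √(1/3)|1⟩` of `|+⟩`; here in the squared, division-free form used downstream.
[cite: Aaronson2005, Thm. 4 (proof)] -/
theorem nine_mul_rejW_le_accW {M : ℕ} {G : ℝ} {j : ℕ} (h1 : (2 : ℝ) ^ j ≤ 2 * G) (h2 : G ≤ 2 ^ j) :
    9 * rejW M G j ≤ accW M G j := by
  unfold rejW accW
  rw [div_pow, div_pow, mul_div_assoc']
  refine div_le_div_of_nonneg_right ?_ (by positivity)
  have h3 : 0 ≤ (2 : ℝ) ^ j - G := by linarith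
  have h4 : 3 * ((2 : ℝ) ^ j - G) ≤ G + 2 ^ j := by linarith
  have h5 : (G - 2 ^ j) ^ 2 = ((2 : ℝ) ^ j - G) ^ 2 := by ring
  rw [h5]
  nlinarith

/-- **A good scale exists** for `2 ≤ G ≤ 2^M`: some `j ∈ [1, M]` has `2^{j-1} < G ≤ 2^j`, hence
`2^j ≤ 2G` (take `j` least with `G ≤ 2^j`). (Aaronson: "since `√(1/2)(2ⁿ - 2s)/s` lies between
`2^{-n}` and `2ⁿ`, there must be an integer `i ∈ [-n, n-1]` …".) [cite: Aaronson2005, Thm. 4 (proof)] -/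
theorem exists_scale {M : ℕ} {G : ℝ} (hG : 2 ≤ G) (hGM : G ≤ 2 ^ M) :
    ∃ j ∈ Finset.Icc 1 M, (2 : ℝ) ^ j ≤ 2 * G ∧ G ≤ 2 ^ j := by
  classical
  have hex : ∃ j : ℕ, G ≤ 2 ^ j := ⟨M, hGM⟩
  have hpos : 0 < Nat.find hex := by
    by_contra h0
    have h0' : Nat.find hex = 0 := by omega
    have := Nat.find_spec hex
    rw [h0', pow_zero] at this
    linarith
  refine ⟨Nat.find hex, ?_, ?_, Nat.find_spec hex⟩
  · rw [Finset.mem_Icc]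
    exact ⟨hpos, Nat.find_min' hex hGM⟩
  · have hlt : ¬ G ≤ 2 ^ (Nat.find hex - 1) := Nat.find_min hex (by omega)
    have heq : (2 : ℝ) ^ Nat.find hex = 2 * 2 ^ (Nat.find hex - 1) := by
      rw [← pow_succ']; congr 1; omega
    rw [heq]
    linarith [not_le.1 hlt]

/-! ### The products over all scales -/

/-- The **acceptance weight** `A = ∏_{j=1}^{M} a_j`: the probability that every `+` block returns
to zero. [cite: Aaronson2005, Thm. 4 (proof) with Prop. 3] -/
def accProd (M : ℕ) (G : ℝ) : ℝ := ∏ j ∈ Finset.Icc 1 M, accW M G j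

/-- The **rejection weight** `R = ∏_{j=1}^{M} r_j`: the probability that every `-` block returns
to zero. [cite: Aaronson2005, Thm. 4 (proof) with Prop. 3] -/
def rejProd (M : ℕ) (G : ℝ) : ℝ := ∏ j ∈ Finset.Icc 1 M, rejW M G j

/-- The symmetry `R(G) = A(-G)`. [folklore] -/
theorem rejProd_eq_accProd_neg (M : ℕ) (G : ℝ) : rejProd M G = accProd M (-G) :=
  Finset.prod_congr rfl fun j _ => rejW_eq_accW_neg M G j

/-- The symmetry `A(G) = R(-G)`. [folklore] -/
theorem accProd_eq_rejProd_neg (M : ℕ) (G : ℝ) : accProd M G = rejProd M (-G) := by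
  rw [rejProd_eq_accProd_neg, neg_neg]

/-- `0 ≤ A`. [folklore] -/
theorem accProd_nonneg (M : ℕ) (G : ℝ) : 0 ≤ accProd M G :=
  Finset.prod_nonneg fun j _ => accW_nonneg M G j

/-- `0 ≤ R`. [folklore] -/
theorem rejProd_nonneg (M : ℕ) (G : ℝ) : 0 ≤ rejProd M G :=
  Finset.prod_nonneg fun j _ => rejW_nonneg M G j

/-- `A ≤ 1` for `|G| ≤ 2^M`. [folklore] -/
theorem accProd_le_one {M : ℕ} {G : ℝ} (hG : |G| ≤ 2 ^ M) : accProd M G ≤ 1 :=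
  Finset.prod_le_one (fun j _ => accW_nonneg M G j) fun _ hj => accW_le_one hG (Finset.mem_Icc.1 hj).2

/-- `R ≤ 1` for `|G| ≤ 2^M`. [folklore] -/
theorem rejProd_le_one {M : ℕ} {G : ℝ} (hG : |G| ≤ 2 ^ M) : rejProd M G ≤ 1 := by
  rw [rejProd_eq_accProd_neg]
  exact accProd_le_one (by rwa [abs_neg])

/-- `A > 0` when `G > 0` (no factor `G + 2^j` vanishes). [folklore] -/
theorem accProd_pos {M : ℕ} {G : ℝ} (hG : 0 < G) : 0 < accProd M G :=
  Finset.prod_pos fun j _ => by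
    have h : 0 < G + 2 ^ j := by positivity
    exact pow_pos (div_pos h (by positivity)) 2

/-- `R > 0` when `G < 0`. [folklore] -/
theorem rejProd_pos {M : ℕ} {G : ℝ} (hG : G < 0) : 0 < rejProd M G := by
  rw [rejProd_eq_accProd_neg]
  exact accProd_pos (by linarith)

/-- **YES instances: `9R ≤ A`.** For `2 ≤ G ≤ 2^M` every scale has `r_j ≤ a_j` and the good scale
of `exists_scale` has `9 r_j ≤ a_j`; multiply. (Aaronson: if `s < 2^{n-1}` some `|φ_{2^i}⟩` is
close to `|+⟩`.) [cite: Aaronson2005, Thm. 4 (proof)] -/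
theorem nine_mul_rejProd_le_accProd {M : ℕ} {G : ℝ} (hG : 2 ≤ G) (hGM : G ≤ 2 ^ M) :
    9 * rejProd M G ≤ accProd M G := by
  obtain ⟨j, hj, h1, h2⟩ := exists_scale hG hGM
  have hG0 : 0 ≤ G := by linarith
  unfold rejProd accProd
  rw [← Finset.mul_prod_erase _ _ hj, ← Finset.mul_prod_erase _ _ hj, ← mul_assoc]
  refine mul_le_mul (nine_mul_rejW_le_accW h1 h2) ?_ ?_ (accW_nonneg M G j)
  · exact Finset.prod_le_prod (fun i _ => rejW_nonneg M G i) fun i _ => rejW_le_accW hG0 i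
  · exact Finset.prod_nonneg fun i _ => rejW_nonneg M G i

/-- **NO instances: `9A ≤ R`.** For `-2^M ≤ G ≤ -2`, by the symmetry `G ↦ -G`. (Aaronson: if
`s ≥ 2^{n-1}` then `|φ_{2^i}⟩` "never lies in the first or third quadrants".)
[cite: Aaronson2005, Thm. 4 (proof)] -/
theorem nine_mul_accProd_le_rejProd {M : ℕ} {G : ℝ} (hG : G ≤ -2) (hGM : -(2 : ℝ) ^ M ≤ G) :
    9 * accProd M G ≤ rejProd M G := by
  have h := nine_mul_rejProd_le_accProd (M := M) (G := -G) (by linarith) (by linarith)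
  rwa [← accProd_eq_rejProd_neg, ← rejProd_eq_accProd_neg] at h

/-- **`A ≤ 9/16`** when `M ≥ 2` and `|G| ≤ 2^M`: the factor of the scale `j = 1` is
`((G + 2)/2^{M+1})² ≤ (1/2 + 2^{-M})² ≤ (3/4)²`, the others are at most `1`. [folklore] -/
theorem accProd_le {M : ℕ} {G : ℝ} (hM : 2 ≤ M) (hG : |G| ≤ 2 ^ M) : accProd M G ≤ 9 / 16 := by
  have h1 : (1 : ℕ) ∈ Finset.Icc 1 M := Finset.mem_Icc.2 ⟨le_rfl, by omega⟩
  unfold accProd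
  rw [← Finset.mul_prod_erase _ _ h1]
  have hrest : ∏ x ∈ (Finset.Icc 1 M).erase 1, accW M G x ≤ 1 :=
    Finset.prod_le_one (fun j _ => accW_nonneg M G j) fun j hj =>
      accW_le_one hG (Finset.mem_Icc.1 (Finset.mem_of_mem_erase hj)).2
  have hfirst : accW M G 1 ≤ 9 / 16 := by
    unfold accW
    have hM4 : (4 : ℝ) ≤ 2 ^ M := by
      calc (4 : ℝ) = 2 ^ 2 := by norm_num
        _ ≤ 2 ^ M := pow_le_pow_right₀ (by norm_num) hM
    have hpos : (0 : ℝ) < 2 ^ (M + 1) := by positivity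
    have hGle : G ≤ 2 ^ M := (le_abs_self G).trans hG
    have hGge : -(2 : ℝ) ^ M ≤ G := by linarith [neg_abs_le G]
    have h2M : (2 : ℝ) ^ (M + 1) = 2 * 2 ^ M := pow_succ' 2 M
    have hup : (G + 2 ^ 1) / 2 ^ (M + 1) ≤ 3 / 4 := by
      rw [div_le_iff₀ hpos, h2M, pow_one]; linarith
    have hlo : -(3 / 4 : ℝ) ≤ (G + 2 ^ 1) / 2 ^ (M + 1) := by
      rw [le_div_iff₀ hpos, h2M, pow_one]; linarith
    nlinarith [abs_le.2 ⟨hlo, hup⟩, sq_abs ((G + 2 ^ 1) / 2 ^ (M + 1))]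
  calc accW M G 1 * ∏ x ∈ (Finset.Icc 1 M).erase 1, accW M G x ≤ 9 / 16 * 1 :=
      mul_le_mul hfirst hrest (Finset.prod_nonneg fun j _ => accW_nonneg M G j) (by norm_num)
    _ = 9 / 16 := by ring

/-! ### The conditional acceptance probability `A / (A + R - A R)` -/

/-- The post-selection weight `A + R - AR = A + R(1 - A)` is positive as soon as `A > 0`, or
`R > 0` and `A < 1`. [folklore] -/
theorem post_weight_pos {A R : ℝ} (hA0 : 0 ≤ A) (hA1 : A ≤ 1) (hR0 : 0 ≤ R)
    (h : 0 < A ∨ (0 < R ∧ A < 1)) : 0 < A + R - A * R := by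
  have e : A + R - A * R = A + R * (1 - A) := by ring
  rw [e]
  rcases h with hA | ⟨hR, hA⟩
  · have : 0 ≤ R * (1 - A) := mul_nonneg hR0 (by linarith)
    linarith
  · have : 0 < R * (1 - A) := mul_pos hR (by linarith)
    linarith

/-- **YES threshold**: `9R ≤ A` and `A > 0` give `2/3 ≤ A/(A + R - AR)` (indeed `≥ 9/10`).
[cite: Aaronson2005, Thm. 4 (proof)] -/
theorem two_thirds_le_cond {A R : ℝ} (h9 : 9 * R ≤ A) (hA : 0 < A) (hA1 : A ≤ 1) (hR0 : 0 ≤ R) :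
    2 / 3 ≤ A / (A + R - A * R) := by
  have hpost : 0 < A + R - A * R := post_weight_pos hA.le hA1 hR0 (Or.inl hA)
  rw [le_div_iff₀ hpost]
  have hAR : 0 ≤ A * R := mul_nonneg hA.le hR0
  nlinarith

/-- **NO threshold**: `9A ≤ R`, `0 ≤ A ≤ 9/16` and `R > 0` give `A/(A + R - AR) ≤ 1/3`
(`R(1 - A) ≥ 7R/16 ≥ 63A/16 ≥ 2A`). [cite: Aaronson2005, Thm. 4 (proof)] -/
theorem cond_le_one_third {A R : ℝ} (h9 : 9 * A ≤ R) (hA0 : 0 ≤ A) (hA : A ≤ 9 / 16) (hR : 0 < R) :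
    A / (A + R - A * R) ≤ 1 / 3 := by
  have hpost : 0 < A + R - A * R :=
    post_weight_pos hA0 (by linarith) hR.le (Or.inr ⟨hR, by linarith⟩)
  rw [div_le_iff₀ hpost]
  nlinarith

end AaronsonPP

end Literature.Computability.QuantumComplexity

end
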